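import Mathlib
import Literature.Analysis.FluidPDE.SelfSimilar
import Literature.Analysis.FluidPDE.AxisymmetricEuler
import Literature.Analysis.FluidPDE.AxisymmetricVorticityTransport
import Literature.Analysis.FluidPDE.TypeIAncientMild
import Summits.NavierStokesRegularity.NavierStokesRegularity.Theorems.QuantisedSymmetryPolyhedralDssProfileExistsStubAncientMildOfClassicalTypeI
import Summits.NavierStokesRegularity.NavierStokesRegularity.Theorems.DssFarFieldSlavingBlowupTypeIDssProfileSmoothRepresentativeAe
import Summits.NavierStokesRegularity.NavierStokesRegularity.Theorems.DssFarFieldSlavingBlowupTypeIDssProfileAxisymmetricEmpty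
import Summits.NavierStokesRegularity.NavierStokesRegularity.Theorems.DssFarFieldSlavingBlowupTypeIDssProfileClassToProfile
import Summits.NavierStokesRegularity.NavierStokesRegularity.Theorems.OddMorawetzMorawetzKillsTypeISelfSimilarRigidity
import HarnessLib

/-!
# STEP-0 control cells E1 (self-similar / «steady profile») and E2 (axisymmetric) at CLASS level
  (route `DssFarFieldSlaving`, crux `BlowupTypeIDssProfile`, stmt-NavierStokesRegularity-0155 —
  SUPPORT; cell pub-ns-dss theory seat g4, EMPTY-CELLS rows E1/E2 «class level after T2»;
  tree-ready file HOME/theory/ControlsClassLevel.lean)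

The hypothesis class of `Theses.FilamentSkeletonRss.RdssProfileTruncation` (H0 `1 < c`, H5 ancient
mild, H4 measurable slices, H2 `IsRotatedDSS c R u`, H3 `HasTypeIDecay M u`, H6 non-triviality
`¬ ∀ t < 0, u t =ᵐ 0`) speaks about an a.e. object `u`. The two classical Liouville theorems used
as solver controls — Tsai 1998 / Nečas–Růžička–Šverák 1996 (no non-trivial SELF-SIMILAR Type-I
profile; tree `stub_selfSimilarRigidity`, classical level) and Koch–Nadirashvili–Seregin–Šverák 2009
(no non-trivial AXISYMMETRIC Type-I ancient mild solution; tree `typeI_ancient_axisymmetric_ae_zero`,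
which asks for POINTWISE axisymmetric slices) — are transferred here to the class with the symmetry
hypothesis stated ALMOST EVERYWHERE per slice, which is the only form a numerical or a.e. object can
carry:

* `isRotatedDSS_of_ae_structure`: an a.e.-per-slice rotated-DSS identity for `u` becomes an exact
  one for the continuous representative (variant of the landed `isRotatedDSS_of_ae_slice_eq`, whose
  structural hypothesis is pointwise).
* `typeI_ancient_aeSelfSimilar_ae_zero` / `rdssClass_aeSelfSimilar_empty` (E1): a.e. self-similar
  for every factor ⇒ every slice is a.e. zero; pointwise corollaries `typeI_ancient_selfSimilar_ae_zero`,
  `rdssClass_selfSimilar_empty`.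
* `typeI_ancient_aeAxisymmetric_ae_zero` / `rdssClass_aeAxisymmetric_empty` (E2): slices
  a.e.-equivariant under every rotation about the axis ⇒ every slice is a.e. zero.

Route in each case: smooth Oseen-gauge representative with the SAME constant
(`typeI_ancient_smoothRepresentative_ae`, KNSS §3–4) → symmetry of the continuous representative
(`Measure.eq_of_ae_eq` / `equivariant_of_ae_equivariant`) → the classical Liouville theorem → back to
`u` along `V t =ᵐ u t`. LEVEL (lead A22): class. Nothing here is numerical.
-/

noncomputable section

set_option linter.dupNamespace false

namespace Summit.NavierStokesRegularity.NavierStokesRegularity.Theorems.ControlsClassLevel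

open MeasureTheory Set Function Literature.Analysis.FluidPDE
open Summit.NavierStokesRegularity.NavierStokesRegularity.Theorems


/-- Continuity of the slices of an Oseen-gauge representative. [folklore] -/
private theorem slice_continuous {C₀ : ℝ} {V : ℝ → (EuclideanSpace ℝ (Fin 3)) → (EuclideanSpace ℝ (Fin 3))} (hT : IsTypeIAncientMild C₀ V) :
    ∀ t < 0, Continuous (V t) := fun t ht => by
  have h : ContinuousOn (uncurry V ∘ fun x : (EuclideanSpace ℝ (Fin 3)) => (t, x)) univ :=
    hT.1.continuousOn.comp (continuous_const.prodMk continuous_id).continuousOn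
      fun x _ => ⟨ht, mem_univ _⟩
  exact (continuousOn_univ.1 h).congr fun x => rfl

/-- **A.e. rotated-DSS structure transfers to the continuous representative**: if for every `t < 0`
the identity `c • R⁻¹ u(c²t, cRx) = u(t, x)` holds for a.e. `x` (`0 < c`), and `V` has continuous
slices on `t < 0`, a.e. equal to those of `u`, with `V t = 0` for `t ≥ 0`, then `V` is rotated
`c`-DSS for `R` at all times and points. [folklore] -/
theorem isRotatedDSS_of_ae_structure {c : ℝ} (hc : 0 < c) {R : (EuclideanSpace ℝ (Fin 3)) ≃ₗᵢ[ℝ] (EuclideanSpace ℝ (Fin 3))}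
    {u V : ℝ → (EuclideanSpace ℝ (Fin 3)) → (EuclideanSpace ℝ (Fin 3))}
    (hdss : ∀ t < 0, (fun x => c • R.symm (u (c ^ 2 * t) (c • R x))) =ᵐ[volume] u t)
    (hVc : ∀ t < 0, Continuous (V t)) (hVu : ∀ t < 0, V t =ᵐ[volume] u t)
    (hV0 : ∀ t, 0 ≤ t → ∀ x, V t x = 0) : IsRotatedDSS c R V := by
  have hc2 : 0 < c ^ 2 := by positivity
  have hq : Measure.QuasiMeasurePreserving (fun x : (EuclideanSpace ℝ (Fin 3)) => c • R x) volume volume :=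
    (Measure.quasiMeasurePreserving_smul volume hc.ne').comp R.measurePreserving.quasiMeasurePreserving
  intro t x
  rcases lt_or_ge t 0 with ht | ht
  · have hct : c ^ 2 * t < 0 := mul_neg_of_pos_of_neg hc2 ht
    have hae : (fun x => c • R.symm (V (c ^ 2 * t) (c • R x))) =ᵐ[volume] V t := by
      have h1 : ∀ᵐ x ∂(volume : Measure (EuclideanSpace ℝ (Fin 3))),
          V (c ^ 2 * t) (c • R x) = u (c ^ 2 * t) (c • R x) := hq.ae (hVu _ hct)
      filter_upwards [h1, hVu t ht, hdss t ht] with x hx hx' hx''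
      rw [hx, hx'', hx']
    have hcont : Continuous fun x => c • R.symm (V (c ^ 2 * t) (c • R x)) :=
      ((R.symm.continuous.comp ((hVc _ hct).comp (R.continuous.const_smul c))).const_smul c)
    exact congrFun (Measure.eq_of_ae_eq hae hcont (hVc t ht)) x
  · rw [hV0 t ht x, hV0 (c ^ 2 * t) (mul_nonneg hc2.le ht) (c • R x), map_zero, smul_zero]

/-! ## E1 — self-similar («steady in similarity variables») members are trivial, class level -/

/-- **E1 at class level (a.e. form).** An ancient mild solution with measurable slices and Type-I
decay `‖u(t,x)‖ ≤ C₀/(‖x‖ + √(−t))` which is self-similar almost everywhere for EVERY factor —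
`λ u(λ²t, λx) = u(t, x)` for a.e. `x`, each `t < 0`, each `λ > 0` — has a.e.-vanishing slices.
Proof: the smooth representative is exactly self-similar (`isRotatedDSS_of_ae_structure` with
`R = 1`), hence zero by Tsai / NRŠ (tree `stub_selfSimilarRigidity`). [cite: Tsai1998, Thm 1; NecasRuzickaSverak1996, Thm 1; KochNadirashviliSereginSverak2009, §4 (arXiv:0709.3599)] -/
theorem typeI_ancient_aeSelfSimilar_ae_zero {u : ℝ → (EuclideanSpace ℝ (Fin 3)) → (EuclideanSpace ℝ (Fin 3))} {C₀ : ℝ}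
    (hmild : IsAncientMildSolution 1 u) (hmeas : ∀ t < 0, AEStronglyMeasurable (u t) volume)
    (hTI : HasTypeIDecay C₀ u)
    (hss : ∀ lam : ℝ, 0 < lam → ∀ t < 0, nsRescale lam u t =ᵐ[volume] u t) :
    ∀ t < 0, u t =ᵐ[volume] 0 := by
  obtain ⟨V, hT, hdec, hVu, hV0⟩ := typeI_ancient_smoothRepresentative_ae hmild hmeas hTI
  have hVc := slice_continuous hT
  have hssV : IsSelfSimilar V := by
    intro lam hlam
    have hR : IsRotatedDSS lam (LinearIsometryEquiv.refl ℝ (EuclideanSpace ℝ (Fin 3))) V :=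
      isRotatedDSS_of_ae_structure hlam (R := LinearIsometryEquiv.refl ℝ (EuclideanSpace ℝ (Fin 3)))
        (fun t ht => by
          have h := hss lam hlam t ht
          have e : nsRescale lam u t = fun x =>
              lam • (LinearIsometryEquiv.refl ℝ (EuclideanSpace ℝ (Fin 3))).symm
                (u (lam ^ 2 * t) (lam • (LinearIsometryEquiv.refl ℝ (EuclideanSpace ℝ (Fin 3))) x)) := rfl
          rw [e] at h
          exact h) hVc hVu hV0
    exact isRotatedDSS_refl_iff.1 hR
  have hz := stub_selfSimilarRigidity C₀ V hT hssV
  intro t ht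
  have hVz : V t = 0 := funext fun x => by simpa using hz t ht x
  exact (hVu t ht).symm.trans (Filter.EventuallyEq.of_eq hVz)

/-- **E1 at class level (pointwise form).** Same with `IsSelfSimilar u` literally. [cite: Tsai1998, Thm 1; KochNadirashviliSereginSverak2009, §4 (arXiv:0709.3599)] -/
theorem typeI_ancient_selfSimilar_ae_zero {u : ℝ → (EuclideanSpace ℝ (Fin 3)) → (EuclideanSpace ℝ (Fin 3))} {C₀ : ℝ}
    (hmild : IsAncientMildSolution 1 u) (hmeas : ∀ t < 0, AEStronglyMeasurable (u t) volume)
    (hTI : HasTypeIDecay C₀ u) (hss : IsSelfSimilar u) :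
    ∀ t < 0, u t =ᵐ[volume] 0 :=
  typeI_ancient_aeSelfSimilar_ae_zero hmild hmeas hTI fun lam hlam t _ =>
    Filter.EventuallyEq.of_eq (congrFun (hss lam hlam) t)

/-- **The self-similar cell of the class is EMPTY** (E1, the STEP-0 «steady profile» control read at
class level): no member of the hypothesis class of `RdssProfileTruncation` (any factor `c > 1`, any
twist `R`, any Type-I bound `M`) is in addition a.e. self-similar for every factor. [cite: Tsai1998, Thm 1; NecasRuzickaSverak1996, Thm 1] -/
theorem rdssClass_aeSelfSimilar_empty (M : ℝ) :
    ¬ ∃ (c : ℝ) (R : (EuclideanSpace ℝ (Fin 3)) ≃ₗᵢ[ℝ] (EuclideanSpace ℝ (Fin 3))) (u : ℝ → (EuclideanSpace ℝ (Fin 3)) → (EuclideanSpace ℝ (Fin 3))), 1 < c ∧ IsAncientMildSolution 1 u ∧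
      (∀ t < 0, AEStronglyMeasurable (u t) volume) ∧ IsRotatedDSS c R u ∧ HasTypeIDecay M u ∧
      (∀ lam : ℝ, 0 < lam → ∀ t < 0, nsRescale lam u t =ᵐ[volume] u t) ∧
      ¬ (∀ t < 0, u t =ᵐ[volume] 0) := by
  rintro ⟨c, R, u, -, hmild, hmeas, -, hdec, hss, hne⟩
  exact hne (typeI_ancient_aeSelfSimilar_ae_zero hmild hmeas hdec hss)

/-- Pointwise variant of `rdssClass_aeSelfSimilar_empty` (`IsSelfSimilar u`). [cite: Tsai1998, Thm 1] -/
theorem rdssClass_selfSimilar_empty (M : ℝ) :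
    ¬ ∃ (c : ℝ) (R : (EuclideanSpace ℝ (Fin 3)) ≃ₗᵢ[ℝ] (EuclideanSpace ℝ (Fin 3))) (u : ℝ → (EuclideanSpace ℝ (Fin 3)) → (EuclideanSpace ℝ (Fin 3))), 1 < c ∧ IsAncientMildSolution 1 u ∧
      (∀ t < 0, AEStronglyMeasurable (u t) volume) ∧ IsRotatedDSS c R u ∧ HasTypeIDecay M u ∧
      IsSelfSimilar u ∧ ¬ (∀ t < 0, u t =ᵐ[volume] 0) := by
  rintro ⟨c, R, u, -, hmild, hmeas, -, hdec, hss, hne⟩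
  exact hne (typeI_ancient_selfSimilar_ae_zero hmild hmeas hdec hss)

/-! ## E2 — a.e.-axisymmetric members are trivial, class level -/

/-- **E2 at class level (a.e. form).** An ancient mild solution with measurable slices and Type-I
decay whose every slice is ALMOST-EVERYWHERE equivariant under every rotation about the axis,
`u t (R_θ x) = R_θ (u t x)` for a.e. `x`, has a.e.-vanishing slices: the continuous representative is
pointwise axisymmetric (`equivariant_of_ae_equivariant`), hence zero by KNSS 2009
(`typeI_ancient_axisymmetric_ae_zero`). [cite: KochNadirashviliSereginSverak2009, Thm 5.3 and §5 (arXiv:0709.3599 p. 10); SereginSverak2009, Thm 1.1 and §1] -/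
theorem typeI_ancient_aeAxisymmetric_ae_zero {u : ℝ → (EuclideanSpace ℝ (Fin 3)) → (EuclideanSpace ℝ (Fin 3))} {C₀ : ℝ}
    (hmild : IsAncientMildSolution 1 u) (hmeas : ∀ t < 0, AEStronglyMeasurable (u t) volume)
    (hTI : HasTypeIDecay C₀ u)
    (hax : ∀ t < 0, ∀ θ : ℝ, (fun x => u t (rotZ θ x)) =ᵐ[volume] fun x => rotZ θ (u t x)) :
    ∀ t < 0, u t =ᵐ[volume] 0 := by
  obtain ⟨V, hT, hdec, hVu, hV0⟩ := typeI_ancient_smoothRepresentative_ae hmild hmeas hTI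
  have hVc := slice_continuous hT
  have haxV : ∀ t < 0, IsAxisymmetric (V t) := fun t ht θ x => by
    have h := equivariant_of_ae_equivariant (rotZLIE θ) (hVc t ht) (hVu t ht)
      (by simpa only [rotZLIE_apply] using hax t ht θ) x
    simpa only [rotZLIE_apply] using h
  have hVmeas : ∀ t < 0, AEStronglyMeasurable (V t) volume := fun t ht =>
    (hVc t ht).aestronglyMeasurable
  have hV0' := typeI_ancient_axisymmetric_ae_zero hT.isAncientMildSolution hVmeas hdec haxV
  exact fun t ht => (hVu t ht).symm.trans (hV0' t ht)

/-- **The a.e.-axisymmetric cell of the class is EMPTY** (E2, the STEP-0 axisymmetric control read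
at class level; strengthens the landed `rdssClass_axisymmetric_empty`, whose symmetry hypothesis is
pointwise): any factor `c > 1`, any twist `R`, any bound `M`. [cite: KochNadirashviliSereginSverak2009, Thm 5.3 (arXiv:0709.3599 p. 10); SereginSverak2009, Thm 1.1] -/
theorem rdssClass_aeAxisymmetric_empty (M : ℝ) :
    ¬ ∃ (c : ℝ) (R : (EuclideanSpace ℝ (Fin 3)) ≃ₗᵢ[ℝ] (EuclideanSpace ℝ (Fin 3))) (u : ℝ → (EuclideanSpace ℝ (Fin 3)) → (EuclideanSpace ℝ (Fin 3))), 1 < c ∧ IsAncientMildSolution 1 u ∧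
      (∀ t < 0, AEStronglyMeasurable (u t) volume) ∧ IsRotatedDSS c R u ∧ HasTypeIDecay M u ∧
      (∀ t < 0, ∀ θ : ℝ, (fun x => u t (rotZ θ x)) =ᵐ[volume] fun x => rotZ θ (u t x)) ∧
      ¬ (∀ t < 0, u t =ᵐ[volume] 0) := by
  rintro ⟨c, R, u, -, hmild, hmeas, -, hdec, hax, hne⟩
  exact hne (typeI_ancient_aeAxisymmetric_ae_zero hmild hmeas hdec hax)

end Summit.NavierStokesRegularity.NavierStokesRegularity.Theorems.ControlsClassLevel

end
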